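import Literature.RingTheory.Binomial.RationalBinomialDenominators
import Literature.NumberTheory.Transcendental.AntiEFunction
import Literature.Barriers.Schanuel.EFunctionValuesAtAlgebraicPointsArith
import HarnessLib

/-!
# The binomial Э-function `∑ s(s−1)⋯(s−n+1) zⁿ` (`s ∈ ℚ`) is an Э-function; Gompertz's constant lies in `𝐃`

`Literature/NumberTheory/Transcendental/BinomialAntiEFunction.lean` — everything PROVED. This is
the ARITHMETIC half of Fischler–Rivoal's example [FischlerRivoal2024, §5.2] ("The Э-function
`𝔣(z) := ∑ s(s−1)⋯(s−n+1) zⁿ` is solution of the inhomogeneous differential equation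
`z²𝔣′(z) + (1 − sz)𝔣(z) − 1 = 0` …"), left open in
`Literature/NumberTheory/Transcendental/AntiEFunction.lean` (its docstring: "NOT here: … the
arithmetic half of the example, i.e. that `aₙ = C(s,n)` … satisfies `IsStrictEFunction`"), and
the first step of the printed proof of [FischlerRivoal2024, Corollary 1]
(`Literature/NumberTheory/Transcendental/FischlerRivoalCorollary1.lean`), which evaluates `𝔣₀` at
`1/α`, i.e. needs the rescaled coefficients `C(s,n) α^{−n}`.

Main results (for `s : ℚ` and an algebraic `c : ℂ`; `chooseSeq s c n = C(s,n) cⁿ`):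

* `isStrictEFunction_chooseSeq` — `∑ C(s,n) cⁿ zⁿ/n!` is a strict `E`-function (Rivoal Déf. 5.2 =
  the tree's `IsStrictEFunction`): coefficients in `ℚ(c)`; the Kummer-type equation
  `z F″ + (1 + cz) F′ − sc F = 0` (`chooseSeq_ode`, from `(n+1) C(s,n+1) = (s−n) C(s,n)`);
  conjugates `C(s,n) σ(c)ⁿ` bounded by `((|s|+1)·house(c))ⁿ`; denominators `(den(s)² d²)ⁿ` with
  `dc ∈ O_ℚ̄`, by `den(s)^{2n} C(s,m) ∈ ℤ` (`m ≤ n`,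
  `Literature/RingTheory/Binomial/RationalBinomialDenominators.lean`).
* `isStrictEFunction_ringChoose`, `isAntiEFunction_antiESeries_ringChoose` — the case `c = 1`:
  `∑ n!·C(s,n) zⁿ = ∑ s(s−1)⋯(s−n+1) zⁿ` is an Э-function.
* `integral_one_add_cpow_mem_antiEValues` — hence, by the analytic half PROVED in
  `AntiEFunction.lean` (`integral_mem_antiEValues_of_isStrictEFunction`), UNCONDITIONALLY
  `∫₀^∞ e^{−t}(1+t)^s dt ∈ 𝐃` for rational `s ≤ 0`; in particular Gompertz's constant
  `δ = ∫₀^∞ e^{−t}/(1+t) dt ∈ 𝐃` (`gompertz_mem_antiEValues`), as printed in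
  [FischlerRivoal2018, §4.3] ("`𝐃` … contains … Gompertz's constant"), and the same in the
  mirror ring `𝐃′` (`integral_one_add_cpow_mem_antiEValues'`).

Not here: the case `s > 0` of the Laplace integral and the evaluation at `1/α` (they belong with
Corollary 1), and anything conditional.

## References

* [FischlerRivoal2024] S. Fischler, T. Rivoal, J. Number Theory 261 (2024), §5.2.
* [FischlerRivoal2018] S. Fischler, T. Rivoal, Amer. J. Math. 140 (2018), §4.3.
* [Rivoal2024] T. Rivoal, *Les E-fonctions et G-fonctions de Siegel*, Définition 5.2.
* [BakerTNT1975] A. Baker, *Transcendental Number Theory*, Ch. 3 §3, p. 37 (denominators).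
-/

noncomputable section

open Finset Polynomial Complex
open scoped Nat

namespace Literature.NumberTheory.Transcendental

open Literature.Barriers.Schanuel Literature.RingTheory.Binomial

/-! ### 1. The coefficient sequence `C(s,n) cⁿ`: growth and recurrence -/

/-- **Growth of binomial coefficients**: `‖C(s,n)‖ ≤ (‖s‖+1)ⁿ` for complex `s`
(`|s − i| ≤ (|s|+1)(i+1)`). [folklore] -/
theorem norm_ringChoose_le (s : ℂ) (n : ℕ) : ‖Ring.choose s n‖ ≤ (‖s‖ + 1) ^ n := by
  rw [ringChoose_eq_prod_range_div, norm_div, norm_prod, Complex.norm_natCast,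
    div_le_iff₀ (by exact_mod_cast n.factorial_pos)]
  induction n with
  | zero => simp
  | succ n ih =>
    rw [Finset.prod_range_succ, Nat.factorial_succ, pow_succ]
    have hsn : ‖s - (n : ℂ)‖ ≤ (‖s‖ + 1) * (n + 1) := by
      calc ‖s - (n : ℂ)‖ ≤ ‖s‖ + ‖(n : ℂ)‖ := norm_sub_le _ _
        _ = ‖s‖ + n := by rw [Complex.norm_natCast]
        _ ≤ (‖s‖ + 1) * (n + 1) := by nlinarith [norm_nonneg s]
    calc (∏ i ∈ Finset.range n, ‖s - (i : ℂ)‖) * ‖s - (n : ℂ)‖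
        ≤ ((‖s‖ + 1) ^ n * (n ! : ℝ)) * ((‖s‖ + 1) * (n + 1)) := by gcongr
      _ = (‖s‖ + 1) ^ n * (‖s‖ + 1) * (((n + 1) * n ! : ℕ) : ℝ) := by push_cast; ring

variable (s : ℚ) (c : ℂ)

/-- The coefficient sequence `aₙ = C(s,n) cⁿ` of the rescaled binomial `E`-, `G`- and Э-series
(`∑ C(s,n) cⁿ ξⁿ = (1 + cξ)^s`). [cite: FischlerRivoal2024, §5.2] -/
def chooseSeq (s : ℚ) (c : ℂ) (n : ℕ) : ℂ := Ring.choose (s : ℂ) n * c ^ n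

/-- Unfolding `chooseSeq`. [cite: FischlerRivoal2024, §5.2] -/
theorem chooseSeq_apply (n : ℕ) : chooseSeq s c n = Ring.choose (s : ℂ) n * c ^ n := rfl

/-- At `c = 1` the sequence is `C(s,n)` itself. [cite: FischlerRivoal2024, §5.2] -/
theorem chooseSeq_one : chooseSeq s 1 = fun n => Ring.choose (s : ℂ) n := by
  funext n
  simp [chooseSeq]

/-- The hypergeometric recurrence `(n+1) aₙ₊₁ = c (s − n) aₙ`. [folklore] -/
theorem chooseSeq_succ (n : ℕ) :
    ((n : ℂ) + 1) * chooseSeq s c (n + 1) = c * ((s : ℂ) - n) * chooseSeq s c n := by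
  simp only [chooseSeq]
  have := succ_mul_ringChoose_succ (s : ℂ) n
  rw [pow_succ]
  linear_combination c * c ^ n * this

/-- Geometric growth `‖aₙ‖ ≤ ((|s|+1)‖c‖)ⁿ`. [folklore] -/
theorem expBound_chooseSeq : ExpBound (chooseSeq s c) := by
  refine ⟨1, (‖(s : ℂ)‖ + 1) * ‖c‖, zero_le_one, by positivity, fun n => ?_⟩
  rw [chooseSeq, norm_mul, norm_pow, one_mul, mul_pow]
  gcongr
  exact norm_ringChoose_le _ _

/-! ### 2. The differential equation (condition (i)) -/

/-- **The Kummer-type equation** `z F″(z) + (1 + c z) F′(z) − s c F(z) = 0` for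
`F(z) = ∑ C(s,n) cⁿ zⁿ/n!` (coefficientwise it is the recurrence `chooseSeq_succ`; for `c = 1`,
`F(z) = ₁F₁(−s; 1; −z)`). PROVED. [folklore] -/
theorem chooseSeq_ode (z : ℂ) :
    z * iteratedDeriv 2 (eSeries (chooseSeq s c)) z
      + (1 + c * z) * iteratedDeriv 1 (eSeries (chooseSeq s c)) z
      - (s : ℂ) * c * eSeries (chooseSeq s c) z = 0 := by
  have ha := expBound_chooseSeq s c
  rw [iteratedDeriv_eSeries ha 2, iteratedDeriv_eSeries ha 1]
  have h2 : z * eSeries (fun n => chooseSeq s c (n + 2)) z =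
      eSeries (fun n => (n : ℂ) * chooseSeq s c (n + 1)) z := by
    rw [(ha.shift_iterate 2).mul_eSeries]
    congr 1
    funext n
    rcases n with _ | n
    · simp
    · simp
  have h1 : (1 + c * z) * eSeries (fun n => chooseSeq s c (n + 1)) z =
      eSeries (fun n => chooseSeq s c (n + 1)) z
        + c * eSeries (fun n => (n : ℂ) * chooseSeq s c n) z := by
    rw [add_mul, one_mul, mul_assoc, (ha.shift_iterate 1).mul_eSeries]
    congr 3
    funext n
    rcases n with _ | n
    · simp
    · simp
  rw [h2, h1]
  have hb1 : ExpBound fun n => (n : ℂ) * chooseSeq s c (n + 1) :=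
    (ha.shift_iterate 2).mulX.of_norm_le fun n => by rcases n with _ | n <;> simp
  have hb2 : ExpBound fun n => chooseSeq s c (n + 1) := ha.shift_iterate 1
  have hb3 : ExpBound fun n => (n : ℂ) * chooseSeq s c n :=
    (ha.shift_iterate 1).mulX.of_norm_le fun n => by rcases n with _ | n <;> simp
  have H := ((hasSum_eSeries hb1 z).add ((hasSum_eSeries hb2 z).add
    ((hasSum_eSeries hb3 z).mul_left c))).sub ((hasSum_eSeries ha z).mul_left ((s : ℂ) * c))
  have hzero : (fun n : ℕ => (n : ℂ) * chooseSeq s c (n + 1) * z ^ n / (n ! : ℂ)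
      + (chooseSeq s c (n + 1) * z ^ n / (n ! : ℂ)
        + c * ((n : ℂ) * chooseSeq s c n * z ^ n / (n ! : ℂ)))
      - (s : ℂ) * c * (chooseSeq s c n * z ^ n / (n ! : ℂ))) = fun _ => 0 := by
    funext n
    have := chooseSeq_succ s c n
    have hn : (n ! : ℂ) ≠ 0 := by exact_mod_cast n.factorial_ne_zero
    field_simp
    linear_combination z ^ n * this
  rw [hzero] at H
  rw [add_sub_assoc, add_sub_assoc] at *
  have := H.unique hasSum_zero
  linear_combination this

/-! ### 3. The arithmetic conditions (ii), (iii) -/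

/-- `C(s,n) cⁿ ∈ ℚ(c)` is algebraic. [folklore] -/
theorem isAlgebraic_chooseSeq (hc : IsAlgebraic ℚ c) (n : ℕ) :
    IsAlgebraic ℚ (chooseSeq s c n) := by
  rw [chooseSeq, ringChoose_ratCast]
  exact (isAlgebraic_algebraMap (R := ℚ) (A := ℂ) (Ring.choose s n)).mul (hc.pow n)

attribute [-instance] DivisionRing.toRatAlgebra in
/-- **Condition (ii)**: the conjugates of `C(s,n) cⁿ` are the `C(s,n) σ(c)ⁿ` (`σ : ℚ̄ → ℂ` fixes
the rational `C(s,n)`), hence bounded by `((‖s‖+1)·M)ⁿ ≤ C^{n+1}` where `M ≥ 1` bounds the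
conjugates of `c`. PROVED. [cite: Rivoal2024, Définition 5.2] -/
theorem norm_conj_chooseSeq_le (hc : IsAlgebraic ℚ c) :
    ∃ C : ℝ, 0 < C ∧ ∀ n, ∀ b ∈ (minpoly ℚ (chooseSeq s c n)).rootSet ℂ, ‖b‖ ≤ C ^ (n + 1) := by
  -- a bound `M` for the conjugates of `c`
  obtain ⟨M, hM⟩ : ∃ M : ℝ, ∀ b ∈ (minpoly ℚ c).rootSet ℂ, ‖b‖ ≤ M := by
    obtain ⟨M, hM⟩ := ((Polynomial.rootSet_finite (minpoly ℚ c) ℂ).image fun b => ‖b‖).bddAbove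
    exact ⟨M, fun b hb => hM (Set.mem_image_of_mem _ hb)⟩
  set Qb := algebraicClosure ℚ ℂ
  have hcQ : c ∈ Qb := mem_algebraicClosure_iff.mpr hc
  set C₀ : ℝ := (‖(s : ℂ)‖ + 1) * max 1 M with hC₀
  have hC₀1 : 1 ≤ C₀ := by
    have : (1 : ℝ) ≤ ‖(s : ℂ)‖ + 1 := by linarith [norm_nonneg (s : ℂ)]
    nlinarith [le_max_left 1 M]
  refine ⟨C₀, one_pos.trans_le hC₀1, fun n b hb => ?_⟩
  have hmem : chooseSeq s c n ∈ Qb := mem_algebraicClosure_iff.mpr (isAlgebraic_chooseSeq s c hc n)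
  obtain ⟨ψ, hψ⟩ := exists_algHom_apply_eq_of_mem_rootSet hmem hb
  -- `ψ` fixes the rational `C(s,n)` and sends `c` to a conjugate
  have hx : (⟨chooseSeq s c n, hmem⟩ : Qb) =
      algebraMap ℚ Qb (Ring.choose s n) * (⟨c, hcQ⟩ : Qb) ^ n := by
    apply Subtype.ext
    simp only [chooseSeq, ringChoose_ratCast]
    rfl
  have hψc : ‖ψ ⟨c, hcQ⟩‖ ≤ max 1 M :=
    (hM _ (algHom_apply_mem_rootSet ψ ⟨c, hcQ⟩)).trans (le_max_right _ _)
  rw [← hψ, hx, map_mul, map_pow, AlgHom.commutes, norm_mul, norm_pow]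
  have h1 : ‖(algebraMap ℚ ℂ) (Ring.choose s n)‖ ≤ (‖(s : ℂ)‖ + 1) ^ n := by
    have := norm_ringChoose_le (s : ℂ) n
    rwa [ringChoose_ratCast] at this
  calc ‖(algebraMap ℚ ℂ) (Ring.choose s n)‖ * ‖ψ ⟨c, hcQ⟩‖ ^ n
      ≤ (‖(s : ℂ)‖ + 1) ^ n * (max 1 M) ^ n := by gcongr
    _ = C₀ ^ n := by rw [hC₀, mul_pow]
    _ ≤ C₀ ^ (n + 1) := pow_le_pow_right₀ hC₀1 (Nat.le_succ n)

/-- **Condition (iii)**: `(den(s)² d²)ⁿ · C(s,m) cᵐ` is an algebraic integer for `m ≤ n`, where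
`dc ∈ O_ℚ̄` (`d ∈ ℤ ∖ {0}`): it is `(den(s)^{2n} C(s,m)) · d^{2n−m} · (dc)^m` and the first factor is
a rational integer (`exists_int_eq_den_pow_mul_ringChoose`). PROVED.
[cite: Rivoal2024, Définition 5.2] -/
theorem exists_den_chooseSeq (hc : IsAlgebraic ℚ c) :
    ∃ (D : ℕ → ℤ) (D₀ : ℝ), 0 < D₀ ∧ ∀ n, 1 ≤ D n ∧ (D n : ℝ) ≤ D₀ ^ (n + 1) ∧
      ∀ m ≤ n, IsIntegral ℤ ((D n : ℂ) * chooseSeq s c m) := by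
  have hcℤ : IsAlgebraic ℤ c := (IsFractionRing.isAlgebraic_iff ℤ ℚ ℂ).mpr hc
  obtain ⟨d, hd, hint⟩ := hcℤ.exists_integral_multiple
  rw [Algebra.smul_def, eq_intCast] at hint
  set q : ℕ := s.den with hq
  have hq0 : q ≠ 0 := s.den_nz
  set B : ℤ := (q : ℤ) ^ 2 * d ^ 2 with hB
  have hB1 : (1 : ℤ) ≤ B := by
    have h1 : (1 : ℤ) ≤ (q : ℤ) ^ 2 := by
      have : (1 : ℤ) ≤ q := by exact_mod_cast Nat.one_le_iff_ne_zero.mpr hq0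
      nlinarith
    have h2 : (1 : ℤ) ≤ d ^ 2 := (one_le_sq_iff_one_le_abs d).mpr (Int.one_le_abs hd)
    rw [hB]; nlinarith
  have hB1' : (1 : ℝ) ≤ (B : ℝ) := by exact_mod_cast hB1
  refine ⟨fun n => B ^ n, (B : ℝ), one_pos.trans_le hB1', fun n => ⟨one_le_pow₀ hB1, ?_, ?_⟩⟩
  · push_cast
    exact pow_le_pow_right₀ hB1' (Nat.le_succ n)
  · intro m hmn
    obtain ⟨z₀, hz₀⟩ := exists_int_eq_den_pow_mul_ringChoose s hmn
    have hchoose : (q : ℂ) ^ (2 * n) * Ring.choose (s : ℂ) m = (z₀ : ℂ) := by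
      have := congrArg (fun x : ℚ => (x : ℂ)) hz₀
      push_cast at this
      rw [ringChoose_ratCast, this]
    have hsplit : ((B ^ n : ℤ) : ℂ) * chooseSeq s c m =
        (z₀ : ℂ) * ((d : ℂ) ^ (2 * n - m) * ((d : ℂ) * c) ^ m) := by
      rw [← hchoose, chooseSeq, hB, mul_pow, ← pow_mul]
      have : (d : ℂ) ^ (2 * n - m) * ((d : ℂ) * c) ^ m = (d : ℂ) ^ (2 * n) * c ^ m := by
        rw [mul_pow, ← mul_assoc, ← pow_add, show 2 * n - m + m = 2 * n by omega]
      rw [this]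
      push_cast
      ring
    rw [hsplit]
    refine IsIntegral.mul ?_ (IsIntegral.mul (IsIntegral.pow ?_ _) (hint.pow m))
    · simpa using isIntegral_algebraMap (R := ℤ) (A := ℂ) (x := z₀)
    · simpa using isIntegral_algebraMap (R := ℤ) (A := ℂ) (x := d)

/-! ### 4. `∑ C(s,n) cⁿ zⁿ/n!` is a strict `E`-function; the binomial Э-function -/

/-- **`∑ₙ C(s,n) cⁿ zⁿ/n!` is a strict `E`-function** for `s ∈ ℚ` and `c ∈ ℚ̄` (Rivoal Déf. 5.2 =
`IsStrictEFunction`): conditions (ii), (iii) above and the equation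
`(−sc)·F + (1 + cX)·F′ + X·F″ = 0`. Equivalently `∑ C(s,n) cⁿ ξⁿ = (1 + cξ)^s` is a `G`-function
and `∑ n! C(s,n) cⁿ zⁿ` an Э-function — the arithmetic half of "the Э-function
`𝔣(z) := ∑ s(s−1)⋯(s−n+1) zⁿ`" (case `c = 1`) and of its rescaling `𝔣(z/α)` (`c = α⁻¹`) used to
evaluate `𝔣₀(1/α)`. PROVED. [cite: FischlerRivoal2024, §5.2] -/
theorem isStrictEFunction_chooseSeq (hc : IsAlgebraic ℚ c) : IsStrictEFunction (chooseSeq s c) := by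
  refine ⟨isAlgebraic_chooseSeq s c hc, ?_, norm_conj_chooseSeq_le s c hc,
    exists_den_chooseSeq s c hc⟩
  -- the ODE `(-s c) F + (1 + c X) F' + X F'' = 0`
  refine ⟨2, ![Polynomial.C (-((s : ℂ) * c)), 1 + Polynomial.C c * Polynomial.X, Polynomial.X],
    ?_, ?_, ?_⟩
  · intro h
    have := congr_fun h 2
    simp at this
  · have hs : IsAlgebraic ℚ ((s : ℂ)) := isAlgebraic_algebraMap (R := ℚ) (A := ℂ) s
    intro j k
    fin_cases j
    · simp only [Fin.zero_eta, Fin.isValue, Matrix.cons_val_zero, Polynomial.coeff_C]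
      split_ifs
      · exact (hs.mul hc).neg
      · exact isAlgebraic_zero
    · simp only [Fin.mk_one, Fin.isValue, Matrix.cons_val_one, Matrix.cons_val_zero,
        Polynomial.coeff_add, Polynomial.coeff_one, Polynomial.coeff_C_mul, Polynomial.coeff_X]
      refine IsAlgebraic.add ?_ ?_
      · split_ifs
        · exact isAlgebraic_one
        · exact isAlgebraic_zero
      · split_ifs
        · simpa using hc
        · simpa using isAlgebraic_zero
    · show IsAlgebraic ℚ ((![Polynomial.C (-((s : ℂ) * c)), 1 + Polynomial.C c * Polynomial.X,
        Polynomial.X] 2).coeff k)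
      simp only [Matrix.cons_val, Polynomial.coeff_X]
      split_ifs
      · exact isAlgebraic_one
      · exact isAlgebraic_zero
  · intro z
    have := chooseSeq_ode s c z
    rw [Fin.sum_univ_three]
    simp only [Fin.isValue, Matrix.cons_val_zero, Polynomial.eval_C, Matrix.cons_val_one,
      Polynomial.eval_add, Polynomial.eval_one, Polynomial.eval_mul, Polynomial.eval_X,
      Matrix.cons_val, iteratedDeriv_zero, Fin.val_zero, Fin.val_one]
    have h2 : ((2 : Fin (2 + 1)) : ℕ) = 2 := rfl
    rw [h2]
    linear_combination this

/-- **`(C(s,n))ₙ` is a strict `E`-coefficient sequence** (`s ∈ ℚ`): `∑ C(s,n) zⁿ/n!` is a strict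
`E`-function. PROVED. [cite: FischlerRivoal2024, §5.2] -/
theorem isStrictEFunction_ringChoose : IsStrictEFunction fun n => Ring.choose (s : ℂ) n := by
  rw [← chooseSeq_one]
  exact isStrictEFunction_chooseSeq s 1 isAlgebraic_one

/-- **Fischler–Rivoal's binomial Э-function**: `𝔣(z) = ∑ s(s−1)⋯(s−n+1) zⁿ = ∑ n!·C(s,n) zⁿ` is an
Э-function for every `s ∈ ℚ` ("The Э-function `𝔣(z) := ∑ s(s−1)⋯(s−n+1)zⁿ`"). PROVED.
[cite: FischlerRivoal2024, §5.2] -/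
theorem isAntiEFunction_antiESeries_ringChoose :
    IsAntiEFunction (antiESeries fun n => Ring.choose (s : ℂ) n) :=
  (isAntiEFunction_antiESeries_iff _).2 (isStrictEFunction_ringChoose s)

/-! ### 5. Unconditional Э-values: `∫₀^∞ e^{−t}(1+t)^s dt ∈ 𝐃`, Gompertz's constant -/

open MeasureTheory Set in
/-- **`∫₀^∞ e^{−t}(1+t)^s dt ∈ 𝐃`** for every rational `s ≤ 0`, UNCONDITIONALLY: the analytic
half `isBorelLaplaceSum_binomial_one` (direction `0` is regular, the `1`-sum is this integral) and
the arithmetic half `isStrictEFunction_ringChoose`. (`s = −1/2` is the number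
`∫₀^∞ e^{−t}/√(1+t) dt` of the Schanuel routes `StokesConstantPi` / `GaussianStokesSector`.)
PROVED. [cite: FischlerRivoal2024, §5.2] -/
theorem integral_one_add_cpow_mem_antiEValues (hs : s ≤ 0) :
    (∫ t in Ioi (0 : ℝ), cexp (-(t : ℂ)) * (1 + (t : ℂ)) ^ (s : ℂ)) ∈ antiEValues := by
  refine integral_mem_antiEValues_of_isStrictEFunction ?_ (isStrictEFunction_ringChoose s)
  simpa using hs

open MeasureTheory Set in
/-- The same values lie in the mirror ring `𝐃′` (`antiEValues'`; the direction `0` is regular, so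
no lateral choice is involved). PROVED. [cite: FischlerRivoal2018, §4.3 (Remark 7)] -/
theorem integral_one_add_cpow_mem_antiEValues' (hs : s ≤ 0) :
    (∫ t in Ioi (0 : ℝ), cexp (-(t : ℂ)) * (1 + (t : ℂ)) ^ (s : ℂ)) ∈ antiEValues' :=
  mem_antiEValues'_of_isBorelLaplaceSum_zero (isStrictEFunction_ringChoose s)
    (isBorelLaplaceSum_binomial_one (by simpa using hs))

open MeasureTheory Set in
/-- **Gompertz's constant `δ = ∫₀^∞ e^{−t}/(1+t) dt` is an Э-value** (`δ ∈ 𝐃`; the case `s = −1`: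
"[`𝐃`] contains algebraic numbers, Gompertz's constant `∫₀^∞ e^{−t}/(1+t) dt` …"). PROVED.
[cite: FischlerRivoal2018, §4.3] -/
theorem gompertz_mem_antiEValues :
    (∫ t in Ioi (0 : ℝ), cexp (-(t : ℂ)) / (1 + (t : ℂ))) ∈ antiEValues := by
  have h := integral_one_add_cpow_mem_antiEValues (-1) (by norm_num)
  have heq : (fun t : ℝ => cexp (-(t : ℂ)) * (1 + (t : ℂ)) ^ (((-1 : ℚ)) : ℂ)) =
      fun t : ℝ => cexp (-(t : ℂ)) / (1 + (t : ℂ)) := by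
    funext t
    rw [show (((-1 : ℚ)) : ℂ) = -1 by push_cast; ring, Complex.cpow_neg_one, div_eq_mul_inv]
  rwa [heq] at h

end Literature.NumberTheory.Transcendental

end
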